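import Mathlib
import Literature.Analysis.FunctionSpaces.TorusCalculusProofs
import Literature.Analysis.FunctionSpaces.FlatTorusProofs

/-!
# Thin-set Liouville lemma, part A: `C¹` calculus on the torus through the lift

Support file for stmt-AnomalousDissipation-1049 (`SteadyNegTameOffThinSets`, routes
CoherentStates / Neg) via the thin-set Liouville lemma (stmt-AnomalousDissipation-1047). The
tree's torus calculus (`Literature.Analysis.FunctionSpaces.TorusCalculus*`) is stated for
globally smooth (`IsSmooth`) or globally `C¹` (`IsContDiff 1`) functions; the Liouville lemma
deals with fields that are `C¹` only off a closed null set. This file provides: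

* local formulas for the torus operators at a point `proj y` in terms of the Fréchet derivative
  of the lift at `y`, assuming only `DifferentiableAt ℝ (lift f) y`
  (`lineDeriv_eq_fderiv_lift`, `partialDeriv_eq_fderiv_lift`, `divergence_eq_sum_fderiv_lift`,
  `convect_eq_fderiv_lift`, `inner_gradient_eq_fderiv_lift`);
* the linear-algebra identity `∑ᵢ L eᵢ * wᵢ = L w` on `ℝ^d` (`sum_apply_single_mul`);
* continuity descends from the lift on open sets (`continuousOn_of_lift`), and a function
  continuous off a closed null set is a.e. strongly measurable
  (`aestronglyMeasurable_of_continuousOn_compl_null`).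

The divergence theorem for `C¹` fields is already in the tree
(`Torus.integral_divergence_eq_zero_of_isContDiff`, `FunctionSpaces/TorusChainRule.lean`) and is
not repeated. All folklore (Evans, PDE, App. C.2; Grafakos, Classical Fourier Analysis §3.1).
-/

set_option linter.dupNamespace false  -- `Summit.AnomalousDissipation.AnomalousDissipation` is the mandated summit/problem namespace

noncomputable section

open MeasureTheory Filter Topology Set
open scoped InnerProductSpace
open Literature.Analysis.FunctionSpaces Literature.Analysis.FunctionSpaces.Torus

namespace Summit.AnomalousDissipation.AnomalousDissipation.Theorems.ThinSetLiouville

variable {d : Type*} [Fintype d] [DecidableEq d]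
variable {F : Type*} [NormedAddCommGroup F] [NormedSpace ℝ F]

/-! ## Local formulas through the lift -/

omit [DecidableEq d] in
/-- If the lift of `f` is differentiable at `y`, the torus directional derivative of `f` at
`proj y` along `v` is `D(lift f)(y) v`. [folklore] -/
theorem lineDeriv_eq_fderiv_lift {f : UnitAddTorus d → F} {y : EuclideanSpace ℝ d}
    (hf : DifferentiableAt ℝ (lift f) y) (v : EuclideanSpace ℝ d) :
    Torus.lineDeriv f (proj y) v = fderiv ℝ (lift f) y v := by
  unfold Torus.lineDeriv
  have h : (fun t : ℝ => f (proj y + proj (t • v))) = fun t => lift f (y + t • v) := by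
    funext t
    rw [lift_apply, proj_add]
  rw [h]
  have h2 : HasDerivAt (fun t : ℝ => y + t • v) v 0 := by
    simpa using ((hasDerivAt_id (0 : ℝ)).smul_const v).const_add y
  have h3 : HasFDerivAt (lift f) (fderiv ℝ (lift f) y) (y + (0 : ℝ) • v) := by
    simpa using hf.hasFDerivAt
  exact (h3.comp_hasDerivAt (0 : ℝ) h2).deriv

/-- Local partial derivatives through the lift: `∂ᵢ f (proj y) = D(lift f)(y) eᵢ`. [folklore] -/
theorem partialDeriv_eq_fderiv_lift {f : UnitAddTorus d → F} {y : EuclideanSpace ℝ d}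
    (hf : DifferentiableAt ℝ (lift f) y) (i : d) :
    partialDeriv i f (proj y) = fderiv ℝ (lift f) y (EuclideanSpace.single i 1) :=
  lineDeriv_eq_fderiv_lift hf _

omit [Fintype d] [DecidableEq d] in
/-- The lift of a coordinate of a vector field is the coordinate of the lift. [folklore] -/
theorem lift_apply_coord (u : UnitAddTorus d → EuclideanSpace ℝ d) (i : d) :
    lift (fun z => u z i) = (EuclideanSpace.proj i : EuclideanSpace ℝ d →L[ℝ] ℝ) ∘ lift u := by
  funext w
  rfl

/-- Local divergence through the lift: `div u (proj y) = ∑ᵢ (D(lift u)(y) eᵢ)ᵢ`. [folklore] -/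
theorem divergence_eq_sum_fderiv_lift {u : UnitAddTorus d → EuclideanSpace ℝ d}
    {y : EuclideanSpace ℝ d} (hu : DifferentiableAt ℝ (lift u) y) :
    divergence u (proj y) = ∑ i, fderiv ℝ (lift u) y (EuclideanSpace.single i 1) i := by
  unfold Torus.divergence
  refine Finset.sum_congr rfl fun i _ => ?_
  have hdi : DifferentiableAt ℝ (lift fun z => u z i) y := by
    rw [lift_apply_coord]
    exact (EuclideanSpace.proj i).differentiableAt.comp y hu
  have h2 : fderiv ℝ ((EuclideanSpace.proj i : EuclideanSpace ℝ d →L[ℝ] ℝ) ∘ lift u) y =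
      (EuclideanSpace.proj i : EuclideanSpace ℝ d →L[ℝ] ℝ).comp (fderiv ℝ (lift u) y) :=
    ((EuclideanSpace.proj i : EuclideanSpace ℝ d →L[ℝ] ℝ).hasFDerivAt.comp y hu.hasFDerivAt).fderiv
  rw [partialDeriv_eq_fderiv_lift hdi, lift_apply_coord, h2]
  rfl

omit [DecidableEq d] in
/-- The convective derivative through the lift: `((u·∇)v)(proj y) = D(lift v)(y) (u (proj y))`
(no differentiability needed, `Torus.fderiv_lift`). [folklore] -/
theorem convect_eq_fderiv_lift (u : UnitAddTorus d → EuclideanSpace ℝ d) (v : UnitAddTorus d → F)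
    (y : EuclideanSpace ℝ d) : convect u v (proj y) = fderiv ℝ (lift v) y (u (proj y)) := by
  rw [Torus.convect, ← fderiv_lift]

omit [DecidableEq d] in
/-- The gradient through the lift: `⟪∇θ (proj y), w⟫ = D(lift θ)(y) w`. [folklore] -/
theorem inner_gradient_eq_fderiv_lift (θ : UnitAddTorus d → ℝ) (y w : EuclideanSpace ℝ d) :
    ⟪Torus.gradient θ (proj y), w⟫_ℝ = fderiv ℝ (lift θ) y w := by
  rw [Torus.inner_gradient_left, fderiv_lift]

/-- On `ℝ^d`, a linear functional satisfies `∑ᵢ L eᵢ * wᵢ = L w`. [folklore] -/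
theorem sum_apply_single_mul (L : EuclideanSpace ℝ d →L[ℝ] ℝ) (w : EuclideanSpace ℝ d) :
    ∑ i, L (EuclideanSpace.single i 1) * w i = L w := by
  conv_rhs => rw [← (EuclideanSpace.basisFun d ℝ).sum_repr w]
  simp [map_sum, map_smul, mul_comm]

/-- On `ℝ^d`, for a linear map into `ℝ^d`-valued... coordinate form of `D(c • w) = c Dw + (Dc) w`:
`∑ᵢ ((Dc eᵢ) • w)ᵢ = Dc w`. [folklore] -/
theorem sum_apply_single_smul_coord (L : EuclideanSpace ℝ d →L[ℝ] ℝ) (w : EuclideanSpace ℝ d) :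
    ∑ i, (L (EuclideanSpace.single i 1) • w) i = L w := by
  rw [← sum_apply_single_mul L w]
  refine Finset.sum_congr rfl fun i _ => ?_
  simp [smul_eq_mul]

/-! ## Continuity and measurability off a closed null set -/

omit [Fintype d] [DecidableEq d] in
/-- Continuity descends from the lift on an open set: if `lift f` is continuous on `proj ⁻¹' A`
with `A` open, then `f` is continuous on `A` (`proj` is an open quotient map). [folklore] -/
theorem continuousOn_of_lift {X : Type*} [TopologicalSpace X] {f : UnitAddTorus d → X}
    {A : Set (UnitAddTorus d)} (hA : IsOpen A) (h : ContinuousOn (lift f) (proj ⁻¹' A)) :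
    ContinuousOn f A := by
  intro x hx
  obtain ⟨y, rfl⟩ := proj_surjective x
  have hy : ContinuousAt (lift f) y :=
    h.continuousAt ((hA.preimage continuous_proj).mem_nhds hx)
  have ht : Tendsto f (𝓝 (proj y)) (𝓝 (f (proj y))) := by
    rw [← isOpenQuotientMap_proj.map_nhds_eq y, Filter.tendsto_map'_iff]
    exact hy
  exact ContinuousAt.continuousWithinAt ht

omit [Fintype d] [DecidableEq d] in
/-- `ContDiffOn` of the lift on `proj ⁻¹' A`, `A` open, gives continuity of `f` on `A`. [folklore] -/
theorem continuousOn_of_contDiffOn_lift [Fintype d] {f : UnitAddTorus d → F} {A : Set (UnitAddTorus d)}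
    (hA : IsOpen A) {n : WithTop ℕ∞} (h : ContDiffOn ℝ n (lift f) (proj ⁻¹' A)) :
    ContinuousOn f A :=
  continuousOn_of_lift hA h.continuousOn

omit [DecidableEq d] in
/-- A function continuous off a closed null set of the torus is a.e. strongly measurable. [folklore] -/
theorem aestronglyMeasurable_of_continuousOn_compl_null {X : Type*} [TopologicalSpace X]
    [TopologicalSpace.PseudoMetrizableSpace X] [SecondCountableTopology X]
    {f : UnitAddTorus d → X} {S : Set (UnitAddTorus d)}
    (hS : IsClosed S) (hS0 : volume S = 0) (hf : ContinuousOn f Sᶜ) :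
    AEStronglyMeasurable f volume := by
  borelize X
  have h1 : AEStronglyMeasurable f (volume.restrict Sᶜ) :=
    hf.aestronglyMeasurable hS.measurableSet.compl
  have h2 : (volume : Measure (UnitAddTorus d)).restrict Sᶜ = volume :=
    Measure.restrict_eq_self_of_ae_mem
      ((measure_eq_zero_iff_ae_notMem.1 hS0).mono fun x hx => hx)
  rwa [h2] at h1

end Summit.AnomalousDissipation.AnomalousDissipation.Theorems.ThinSetLiouville

end
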